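import Summits.QuantumFields.YangMills.Theorems.EquipartitionCriticalityFreeEnergyLogCoefficientExpLipschitz
import HarnessLib

/-!
# Crux `FemtoCurvatureTwoPointC` (stmt-QuantumFields-16204), line `Sketch`, v7 — matrix algebra for the cone estimate

Lead's package behind `stub_sublevelDoubling`, file P3a (`--supports stmt-QuantumFields-16204`): the second-order expansion of a
four-fold product of exponentials of skew-Hermitian matrices (Frobenius norm),

  `‖e^{X₁+Y₁} e^{X₂+Y₂} e^{X₃+Y₃} e^{X₄+Y₄} − e^{X₁} e^{X₂} e^{X₃} e^{X₄} − (Y₁+Y₂+Y₃+Y₄)‖ ≤ 3 σ (‖Y₁‖+‖Y₂‖+‖Y₃‖+‖Y₄‖)`,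
  `σ = Σ_k (‖X_k‖ + ‖Y_k‖)`, when all `‖X_k‖, ‖Y_k‖ ≤ 1/4`

(`norm_prod_exp_sub_prod_exp_sub_sum_le`), together with the Frobenius polarisation identity
`‖X + Y‖² = ‖X‖² + ‖Y‖² + 2 Re tr(Xᴴ Y)` and the elementary unitary bookkeeping it needs. In the cone estimate the `X_k` are the
zero-mode parts and the `Y_k` the massive parts of the four link variables of a plaquette. Everything here is proved; no definitions.
-/

set_option autoImplicit false

noncomputable section

open scoped Matrix Matrix.Norms.Frobenius
open NormedSpace
open Summit.QuantumFields.YangMills.Theorems.FreeEnergyLogCoefficient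

namespace Summit.QuantumFields.YangMills.Theorems.FemtoCurvatureTwoPointC.Doubling.ConeAlgebra

section Aux

variable {N : ℕ}


/-! ### Unitary bookkeeping -/

/-- `‖U V − 1‖ ≤ ‖U − 1‖ + ‖V − 1‖` when the RIGHT factor `V` is unitary (`U V − 1 = (U − 1) V + (V − 1)`). -/
theorem norm_mul_sub_one_le_of_right (U : Matrix (Fin N) (Fin N) ℂ) {V : Matrix (Fin N) (Fin N) ℂ}
    (hV : V ∈ Matrix.unitaryGroup (Fin N) ℂ) : ‖U * V - 1‖ ≤ ‖U - 1‖ + ‖V - 1‖ := by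
  have e : U * V - 1 = (U - 1) * V + (V - 1) := by rw [Matrix.sub_mul, Matrix.one_mul]; abel
  rw [e]
  calc ‖(U - 1) * V + (V - 1)‖ ≤ ‖(U - 1) * V‖ + ‖V - 1‖ := norm_add_le _ _
    _ = ‖U - 1‖ + ‖V - 1‖ := by rw [Matrix.frobenius_norm_mul_unitaryGroup _ ⟨V, hV⟩]

/-- The exponential of a skew-Hermitian matrix is unitary. -/
theorem exp_mem_unitary {X : Matrix (Fin N) (Fin N) ℂ} (hX : Xᴴ = -X) : exp X ∈ Matrix.unitaryGroup (Fin N) ℂ :=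
  exp_mem_unitaryGroup_of_skew hX

/-- Sums of skew-Hermitian matrices are skew-Hermitian. -/
theorem skew_add {X Y : Matrix (Fin N) (Fin N) ℂ} (hX : Xᴴ = -X) (hY : Yᴴ = -Y) : (X + Y)ᴴ = -(X + Y) := by
  rw [Matrix.conjTranspose_add, hX, hY, neg_add]

/-! ### The Frobenius polarisation identity -/

/-- **Polarisation**: `‖X + Y‖² = ‖X‖² + ‖Y‖² + 2 Re tr(Xᴴ Y)` for the Frobenius norm. -/
theorem norm_add_sq_eq (X Y : Matrix (Fin N) (Fin N) ℂ) : ‖X + Y‖ ^ 2 = ‖X‖ ^ 2 + ‖Y‖ ^ 2 + 2 * (Xᴴ * Y).trace.re := by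
  have hXY : ((Yᴴ * X).trace).re = ((Xᴴ * Y).trace).re := by
    have h : (Yᴴ * X) = (Xᴴ * Y)ᴴ := by rw [Matrix.conjTranspose_mul, Matrix.conjTranspose_conjTranspose]
    rw [h, Matrix.trace_conjTranspose, RCLike.star_def, Complex.conj_re]
  rw [Matrix.frobenius_norm_sq_eq_re_trace, Matrix.frobenius_norm_sq_eq_re_trace, Matrix.frobenius_norm_sq_eq_re_trace,
    Matrix.conjTranspose_add, Matrix.add_mul, Matrix.mul_add, Matrix.mul_add, Matrix.trace_add, Matrix.trace_add,
    Matrix.trace_add, map_add, map_add, map_add]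
  simp only [RCLike.re_to_complex] at hXY ⊢
  rw [hXY]; ring

/-- `‖a + e‖² ≥ ‖a‖²/2 − ‖e‖²`. -/
theorem half_sq_sub_sq_le_norm_add_sq (a e : Matrix (Fin N) (Fin N) ℂ) : ‖a‖ ^ 2 / 2 - ‖e‖ ^ 2 ≤ ‖a + e‖ ^ 2 := by
  have h1 : ‖a‖ ≤ ‖a + e‖ + ‖e‖ := by
    have := norm_add_le (a + e) (-e)
    rwa [add_neg_cancel_right, norm_neg] at this
  nlinarith [norm_nonneg (a + e), norm_nonneg e, norm_nonneg a, sq_nonneg (‖a + e‖ - ‖e‖)]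

/-- `‖a + b + e‖² ≤ 3 (‖a‖² + ‖b‖² + ‖e‖²)`. -/
theorem norm_add_add_sq_le (a b e : Matrix (Fin N) (Fin N) ℂ) : ‖a + b + e‖ ^ 2 ≤ 3 * (‖a‖ ^ 2 + ‖b‖ ^ 2 + ‖e‖ ^ 2) := by
  have h1 : ‖a + b + e‖ ≤ ‖a‖ + ‖b‖ + ‖e‖ := norm_add₃_le
  nlinarith [norm_nonneg (a + b + e), norm_nonneg a, norm_nonneg b, norm_nonneg e, sq_nonneg (‖a‖ - ‖b‖),
    sq_nonneg (‖b‖ - ‖e‖), sq_nonneg (‖a‖ - ‖e‖)]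

/-! ### First order expansion of one exponential -/

/-- `e^{X+Y} = e^X + Y + R` with `‖R‖ ≤ 2 (‖X‖ + ‖Y‖) ‖Y‖` when `‖X‖, ‖Y‖ ≤ 1/4`. -/
theorem norm_exp_add_sub_exp_sub_le {X Y : Matrix (Fin N) (Fin N) ℂ} (hX : ‖X‖ ≤ 1 / 4) (hY : ‖Y‖ ≤ 1 / 4) :
    ‖exp (X + Y) - exp X - Y‖ ≤ 2 * (‖X‖ + ‖Y‖) * ‖Y‖ := by
  have hr1 : ‖X + Y‖ ≤ ‖X‖ + ‖Y‖ := norm_add_le X Y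
  have hr2 : ‖X‖ ≤ ‖X‖ + ‖Y‖ := le_add_of_nonneg_right (norm_nonneg Y)
  have h := norm_exp_sub_exp_sub_le (X := X + Y) (Y := X) hr1 hr2
  rw [add_sub_cancel_left] at h
  have hr : ‖X‖ + ‖Y‖ ≤ 1 / 2 := by linarith
  have h0 : 0 ≤ ‖X‖ + ‖Y‖ := by positivity
  -- `e^r − 1 ≤ 2 r` for `0 ≤ r ≤ 1/2`
  have hexp : Real.exp (‖X‖ + ‖Y‖) - 1 ≤ 2 * (‖X‖ + ‖Y‖) := by
    have h1 : Real.exp (‖X‖ + ‖Y‖) ≤ 1 + (‖X‖ + ‖Y‖) + (‖X‖ + ‖Y‖) ^ 2 := by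
      have := Real.abs_exp_sub_one_sub_id_le (x := ‖X‖ + ‖Y‖) (by rw [abs_of_nonneg h0]; linarith)
      have h2 := (abs_le.1 this).2
      linarith
    nlinarith
  exact h.trans (mul_le_mul_of_nonneg_right hexp (norm_nonneg Y))

/-! ### The four-fold product -/

/-- Telescoping identity for a four-fold product (noncommutative ring). -/
theorem prod_four_sub_prod_four (V₁ V₂ V₃ V₄ U₁ U₂ U₃ U₄ : Matrix (Fin N) (Fin N) ℂ) :
    V₁ * V₂ * V₃ * V₄ - U₁ * U₂ * U₃ * U₄ =
      (V₁ - U₁) * (U₂ * U₃ * U₄) + V₁ * (V₂ - U₂) * (U₃ * U₄) + V₁ * V₂ * (V₃ - U₃) * U₄ +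
        V₁ * V₂ * V₃ * (V₄ - U₄) := by
  simp only [Matrix.sub_mul, Matrix.mul_sub, Matrix.mul_assoc]; abel

/-- One telescoping term: `‖P (Y + R) Q − Y‖ ≤ ‖R‖ + (‖P − 1‖ + ‖Q − 1‖) ‖Y‖` for unitary `P, Q`. -/
theorem norm_term_le {P Q : Matrix (Fin N) (Fin N) ℂ} (hP : P ∈ Matrix.unitaryGroup (Fin N) ℂ) (hQ : Q ∈ Matrix.unitaryGroup (Fin N) ℂ)
    (Y R : Matrix (Fin N) (Fin N) ℂ) : ‖P * (Y + R) * Q - Y‖ ≤ ‖R‖ + (‖P - 1‖ + ‖Q - 1‖) * ‖Y‖ := by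
  have e : P * (Y + R) * Q - Y = P * R * Q + (P - 1) * Y * Q + Y * (Q - 1) := by
    simp only [Matrix.mul_add, Matrix.add_mul, Matrix.sub_mul, Matrix.mul_sub, Matrix.one_mul, Matrix.mul_one]; abel
  rw [e]
  calc ‖P * R * Q + (P - 1) * Y * Q + Y * (Q - 1)‖
        ≤ ‖P * R * Q‖ + ‖(P - 1) * Y * Q‖ + ‖Y * (Q - 1)‖ := norm_add₃_le
    _ ≤ ‖R‖ + ‖P - 1‖ * ‖Y‖ + ‖Y‖ * ‖Q - 1‖ := by
        rw [Matrix.frobenius_norm_mul_unitaryGroup _ ⟨Q, hQ⟩, Matrix.frobenius_norm_unitaryGroup_mul ⟨P, hP⟩,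
          Matrix.frobenius_norm_mul_unitaryGroup _ ⟨Q, hQ⟩]
        exact add_le_add (add_le_add le_rfl (norm_mul_le _ _)) (norm_mul_le _ _)
    _ = ‖R‖ + (‖P - 1‖ + ‖Q - 1‖) * ‖Y‖ := by ring

/-- **Abstract second-order expansion of a four-fold product**: if `V_k − U_k = Y_k + R_k` with `V₁, V₂, V₃, U₂, U₃, U₄`
unitary, then `V₁V₂V₃V₄ − U₁U₂U₃U₄ − Σ Y_k` is bounded by the remainders plus (distances of partial products to `1`) × `‖Y_k‖`. -/
theorem norm_prod_sub_prod_sub_sum_le {V₁ V₂ V₃ V₄ U₁ U₂ U₃ U₄ Y₁ Y₂ Y₃ Y₄ R₁ R₂ R₃ R₄ : Matrix (Fin N) (Fin N) ℂ}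
    (uV₁ : V₁ ∈ Matrix.unitaryGroup (Fin N) ℂ) (uV₂ : V₂ ∈ Matrix.unitaryGroup (Fin N) ℂ)
    (uV₃ : V₃ ∈ Matrix.unitaryGroup (Fin N) ℂ) (uU₂ : U₂ ∈ Matrix.unitaryGroup (Fin N) ℂ)
    (uU₃ : U₃ ∈ Matrix.unitaryGroup (Fin N) ℂ) (uU₄ : U₄ ∈ Matrix.unitaryGroup (Fin N) ℂ)
    (h₁ : V₁ - U₁ = Y₁ + R₁) (h₂ : V₂ - U₂ = Y₂ + R₂) (h₃ : V₃ - U₃ = Y₃ + R₃) (h₄ : V₄ - U₄ = Y₄ + R₄) :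
    ‖V₁ * V₂ * V₃ * V₄ - U₁ * U₂ * U₃ * U₄ - (Y₁ + Y₂ + Y₃ + Y₄)‖ ≤
      (‖R₁‖ + (‖(1 : Matrix (Fin N) (Fin N) ℂ) - 1‖ + ‖U₂ * U₃ * U₄ - 1‖) * ‖Y₁‖) + (‖R₂‖ + (‖V₁ - 1‖ + ‖U₃ * U₄ - 1‖) * ‖Y₂‖) +
        (‖R₃‖ + (‖V₁ * V₂ - 1‖ + ‖U₄ - 1‖) * ‖Y₃‖) + (‖R₄‖ + (‖V₁ * V₂ * V₃ - 1‖ + ‖(1 : Matrix (Fin N) (Fin N) ℂ) - 1‖) * ‖Y₄‖) := by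
  have u1 : (1 : Matrix (Fin N) (Fin N) ℂ) ∈ Matrix.unitaryGroup (Fin N) ℂ := Submonoid.one_mem _
  have umul : ∀ {A B : Matrix (Fin N) (Fin N) ℂ}, A ∈ Matrix.unitaryGroup (Fin N) ℂ → B ∈ Matrix.unitaryGroup (Fin N) ℂ →
      A * B ∈ Matrix.unitaryGroup (Fin N) ℂ := fun hA hB => Submonoid.mul_mem _ hA hB
  have hdec : V₁ * V₂ * V₃ * V₄ - U₁ * U₂ * U₃ * U₄ - (Y₁ + Y₂ + Y₃ + Y₄) =
      (1 * (Y₁ + R₁) * (U₂ * U₃ * U₄) - Y₁) + (V₁ * (Y₂ + R₂) * (U₃ * U₄) - Y₂) +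
        (V₁ * V₂ * (Y₃ + R₃) * U₄ - Y₃) + (V₁ * V₂ * V₃ * (Y₄ + R₄) * 1 - Y₄) := by
    rw [prod_four_sub_prod_four, h₁, h₂, h₃, h₄, Matrix.one_mul, Matrix.mul_one]; abel
  rw [hdec]
  have t1 := norm_term_le u1 (umul (umul uU₂ uU₃) uU₄) Y₁ R₁
  have t2 := norm_term_le uV₁ (umul uU₃ uU₄) Y₂ R₂
  have t3 := norm_term_le (umul uV₁ uV₂) uU₄ Y₃ R₃
  have t4 := norm_term_le (umul (umul uV₁ uV₂) uV₃) u1 Y₄ R₄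
  calc _ ≤ ‖1 * (Y₁ + R₁) * (U₂ * U₃ * U₄) - Y₁‖ + ‖V₁ * (Y₂ + R₂) * (U₃ * U₄) - Y₂‖ +
          ‖V₁ * V₂ * (Y₃ + R₃) * U₄ - Y₃‖ + ‖V₁ * V₂ * V₃ * (Y₄ + R₄) * 1 - Y₄‖ := by
        refine (norm_add_le _ _).trans (add_le_add ((norm_add_le _ _).trans (add_le_add (norm_add_le _ _) le_rfl))
          le_rfl)
    _ ≤ _ := add_le_add (add_le_add (add_le_add t1 t2) t3) t4

end Aux

/-- **Second-order expansion of a four-fold product of exponentials** (skew-Hermitian, Frobenius): with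
`σ = Σ_k (‖X_k‖ + ‖Y_k‖)` and all norms `≤ 1/4`,
`‖e^{X₁+Y₁} e^{X₂+Y₂} e^{X₃+Y₃} e^{X₄+Y₄} − e^{X₁} e^{X₂} e^{X₃} e^{X₄} − (Y₁+Y₂+Y₃+Y₄)‖ ≤ 3 σ (‖Y₁‖+‖Y₂‖+‖Y₃‖+‖Y₄‖)`. -/
theorem norm_prod_exp_sub_prod_exp_sub_sum_le : ∀ {N : ℕ} {X₁ X₂ X₃ X₄ Y₁ Y₂ Y₃ Y₄ : Matrix (Fin N) (Fin N) ℂ}, X₁ᴴ = -X₁ → X₂ᴴ = -X₂ → X₃ᴴ = -X₃ → X₄ᴴ = -X₄ → Y₁ᴴ = -Y₁ → Y₂ᴴ = -Y₂ → Y₃ᴴ = -Y₃ → ‖X₁‖ ≤ 1 / 4 → ‖X₂‖ ≤ 1 / 4 → ‖X₃‖ ≤ 1 / 4 → ‖X₄‖ ≤ 1 / 4 → ‖Y₁‖ ≤ 1 / 4 → ‖Y₂‖ ≤ 1 / 4 → ‖Y₃‖ ≤ 1 / 4 → ‖Y₄‖ ≤ 1 / 4 → ‖NormedSpace.exp (X₁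 + Y₁) * NormedSpace.exp (X₂ + Y₂) * NormedSpace.exp (X₃ + Y₃) * NormedSpace.exp (X₄ + Y₄) - NormedSpace.exp X₁ * NormedSpace.exp X₂ * NormedSpace.exp X₃ * NormedSpace.exp X₄ - (Y₁ + Y₂ + Y₃ + Y₄)‖ ≤ 3 * ((‖X₁‖ + ‖Y₁‖) + (‖X₂‖ + ‖Y₂‖) + (‖X₃‖ + ‖Y₃‖) + (‖X₄‖ + ‖Y₄‖)) * (‖Y₁‖ + ‖Y₂‖ + ‖Y₃‖ + ‖Y₄‖) := by
  intro N X₁ X₂ X₃ X₄ Y₁ Y₂ Y₃ Y₄ hX₁ hX₂ hX₃ hX₄ hY₁ hY₂ hY₃ nX₁ nX₂ nX₃ nX₄ nY₁ nY₂ nY₃ nY₄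
  have uV₁ : exp (X₁ + Y₁) ∈ Matrix.unitaryGroup (Fin N) ℂ := exp_mem_unitary (skew_add hX₁ hY₁)
  have uV₂ : exp (X₂ + Y₂) ∈ Matrix.unitaryGroup (Fin N) ℂ := exp_mem_unitary (skew_add hX₂ hY₂)
  have uV₃ : exp (X₃ + Y₃) ∈ Matrix.unitaryGroup (Fin N) ℂ := exp_mem_unitary (skew_add hX₃ hY₃)
  have uU₂ : exp X₂ ∈ Matrix.unitaryGroup (Fin N) ℂ := exp_mem_unitary hX₂
  have uU₃ : exp X₃ ∈ Matrix.unitaryGroup (Fin N) ℂ := exp_mem_unitary hX₃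
  have uU₄ : exp X₄ ∈ Matrix.unitaryGroup (Fin N) ℂ := exp_mem_unitary hX₄
  have umul : ∀ {A B : Matrix (Fin N) (Fin N) ℂ}, A ∈ Matrix.unitaryGroup (Fin N) ℂ → B ∈ Matrix.unitaryGroup (Fin N) ℂ →
      A * B ∈ Matrix.unitaryGroup (Fin N) ℂ := fun hA hB => Submonoid.mul_mem _ hA hB
  -- distances to `1`
  have dV : ∀ {X Y : Matrix (Fin N) (Fin N) ℂ}, Xᴴ = -X → Yᴴ = -Y → ‖exp (X + Y) - 1‖ ≤ ‖X‖ + ‖Y‖ := fun hX hY =>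
    (norm_exp_sub_one_le_of_skew (skew_add hX hY)).trans (norm_add_le _ _)
  have dU : ∀ {X : Matrix (Fin N) (Fin N) ℂ}, Xᴴ = -X → ‖exp X - 1‖ ≤ ‖X‖ := fun hX => norm_exp_sub_one_le_of_skew hX
  -- remainders
  have r1 : ‖exp (X₁ + Y₁) - exp X₁ - Y₁‖ ≤ 2 * (‖X₁‖ + ‖Y₁‖) * ‖Y₁‖ := norm_exp_add_sub_exp_sub_le nX₁ nY₁
  have r2 : ‖exp (X₂ + Y₂) - exp X₂ - Y₂‖ ≤ 2 * (‖X₂‖ + ‖Y₂‖) * ‖Y₂‖ := norm_exp_add_sub_exp_sub_le nX₂ nY₂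
  have r3 : ‖exp (X₃ + Y₃) - exp X₃ - Y₃‖ ≤ 2 * (‖X₃‖ + ‖Y₃‖) * ‖Y₃‖ := norm_exp_add_sub_exp_sub_le nX₃ nY₃
  have r4 : ‖exp (X₄ + Y₄) - exp X₄ - Y₄‖ ≤ 2 * (‖X₄‖ + ‖Y₄‖) * ‖Y₄‖ := norm_exp_add_sub_exp_sub_le nX₄ nY₄
  have e1 : exp (X₁ + Y₁) - exp X₁ = Y₁ + (exp (X₁ + Y₁) - exp X₁ - Y₁) := by abel
  have e2 : exp (X₂ + Y₂) - exp X₂ = Y₂ + (exp (X₂ + Y₂) - exp X₂ - Y₂) := by abel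
  have e3 : exp (X₃ + Y₃) - exp X₃ = Y₃ + (exp (X₃ + Y₃) - exp X₃ - Y₃) := by abel
  have e4 : exp (X₄ + Y₄) - exp X₄ = Y₄ + (exp (X₄ + Y₄) - exp X₄ - Y₄) := by abel
  have main := norm_prod_sub_prod_sub_sum_le uV₁ uV₂ uV₃ uU₂ uU₃ uU₄ e1 e2 e3 e4
  -- distances of the products to `1`
  have h11 : ‖(1 : Matrix (Fin N) (Fin N) ℂ) - 1‖ = 0 := by simp
  have d2 := dU hX₂; have d3 := dU hX₃; have d4 := dU hX₄
  have v1 := dV hX₁ hY₁; have v2 := dV hX₂ hY₂; have v3 := dV hX₃ hY₃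
  have m23 : ‖exp X₂ * exp X₃ - 1‖ ≤ ‖exp X₂ - 1‖ + ‖exp X₃ - 1‖ := norm_mul_sub_one_le_of_right (exp X₂) uU₃
  have m234 : ‖exp X₂ * exp X₃ * exp X₄ - 1‖ ≤ ‖exp X₂ * exp X₃ - 1‖ + ‖exp X₄ - 1‖ :=
    norm_mul_sub_one_le_of_right (exp X₂ * exp X₃) uU₄
  have m34 : ‖exp X₃ * exp X₄ - 1‖ ≤ ‖exp X₃ - 1‖ + ‖exp X₄ - 1‖ := norm_mul_sub_one_le_of_right (exp X₃) uU₄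
  have w12 : ‖exp (X₁ + Y₁) * exp (X₂ + Y₂) - 1‖ ≤ ‖exp (X₁ + Y₁) - 1‖ + ‖exp (X₂ + Y₂) - 1‖ :=
    norm_mul_sub_one_le_of_right (exp (X₁ + Y₁)) uV₂
  have w123 : ‖exp (X₁ + Y₁) * exp (X₂ + Y₂) * exp (X₃ + Y₃) - 1‖ ≤
      ‖exp (X₁ + Y₁) * exp (X₂ + Y₂) - 1‖ + ‖exp (X₃ + Y₃) - 1‖ :=
    norm_mul_sub_one_le_of_right (exp (X₁ + Y₁) * exp (X₂ + Y₂)) uV₃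
  have p1 : ‖(1 : Matrix (Fin N) (Fin N) ℂ) - 1‖ + ‖exp X₂ * exp X₃ * exp X₄ - 1‖ ≤ ‖X₂‖ + ‖X₃‖ + ‖X₄‖ := by
    rw [h11]; linarith
  have p2 : ‖exp (X₁ + Y₁) - 1‖ + ‖exp X₃ * exp X₄ - 1‖ ≤ (‖X₁‖ + ‖Y₁‖) + (‖X₃‖ + ‖X₄‖) := by linarith
  have p3 : ‖exp (X₁ + Y₁) * exp (X₂ + Y₂) - 1‖ + ‖exp X₄ - 1‖ ≤ ((‖X₁‖ + ‖Y₁‖) + (‖X₂‖ + ‖Y₂‖)) + ‖X₄‖ := by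
    linarith
  have p4 : ‖exp (X₁ + Y₁) * exp (X₂ + Y₂) * exp (X₃ + Y₃) - 1‖ + ‖(1 : Matrix (Fin N) (Fin N) ℂ) - 1‖ ≤
      (‖X₁‖ + ‖Y₁‖) + (‖X₂‖ + ‖Y₂‖) + (‖X₃‖ + ‖Y₃‖) := by
    rw [h11]; linarith
  -- assemble (everything linear once the products are bounded)
  set σ := (‖X₁‖ + ‖Y₁‖) + (‖X₂‖ + ‖Y₂‖) + (‖X₃‖ + ‖Y₃‖) + (‖X₄‖ + ‖Y₄‖) with hσ
  have n1 := norm_nonneg X₁; have n2 := norm_nonneg X₂; have n3 := norm_nonneg X₃; have n4 := norm_nonneg X₄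
  have n5 := norm_nonneg Y₁; have n6 := norm_nonneg Y₂; have n7 := norm_nonneg Y₃; have n8 := norm_nonneg Y₄
  have s1 : ‖X₁‖ + ‖Y₁‖ ≤ σ := by rw [hσ]; linarith
  have s2 : ‖X₂‖ + ‖Y₂‖ ≤ σ := by rw [hσ]; linarith
  have s3 : ‖X₃‖ + ‖Y₃‖ ≤ σ := by rw [hσ]; linarith
  have s4 : ‖X₄‖ + ‖Y₄‖ ≤ σ := by rw [hσ]; linarith
  have q1 : ‖(1 : Matrix (Fin N) (Fin N) ℂ) - 1‖ + ‖exp X₂ * exp X₃ * exp X₄ - 1‖ ≤ σ := p1.trans (by rw [hσ]; linarith)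
  have q2 : ‖exp (X₁ + Y₁) - 1‖ + ‖exp X₃ * exp X₄ - 1‖ ≤ σ := p2.trans (by rw [hσ]; linarith)
  have q3 : ‖exp (X₁ + Y₁) * exp (X₂ + Y₂) - 1‖ + ‖exp X₄ - 1‖ ≤ σ := p3.trans (by rw [hσ]; linarith)
  have q4 : ‖exp (X₁ + Y₁) * exp (X₂ + Y₂) * exp (X₃ + Y₃) - 1‖ + ‖(1 : Matrix (Fin N) (Fin N) ℂ) - 1‖ ≤ σ := p4.trans (by rw [hσ]; linarith)
  have a1 : ‖exp (X₁ + Y₁) - exp X₁ - Y₁‖ ≤ 2 * σ * ‖Y₁‖ :=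
    r1.trans (mul_le_mul_of_nonneg_right (mul_le_mul_of_nonneg_left s1 (by norm_num)) n5)
  have a2 : ‖exp (X₂ + Y₂) - exp X₂ - Y₂‖ ≤ 2 * σ * ‖Y₂‖ :=
    r2.trans (mul_le_mul_of_nonneg_right (mul_le_mul_of_nonneg_left s2 (by norm_num)) n6)
  have a3 : ‖exp (X₃ + Y₃) - exp X₃ - Y₃‖ ≤ 2 * σ * ‖Y₃‖ :=
    r3.trans (mul_le_mul_of_nonneg_right (mul_le_mul_of_nonneg_left s3 (by norm_num)) n7)
  have a4 : ‖exp (X₄ + Y₄) - exp X₄ - Y₄‖ ≤ 2 * σ * ‖Y₄‖ :=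
    r4.trans (mul_le_mul_of_nonneg_right (mul_le_mul_of_nonneg_left s4 (by norm_num)) n8)
  have b1 := mul_le_mul_of_nonneg_right q1 n5
  have b2 := mul_le_mul_of_nonneg_right q2 n6
  have b3 := mul_le_mul_of_nonneg_right q3 n7
  have b4 := mul_le_mul_of_nonneg_right q4 n8
  refine main.trans ?_
  have e : 3 * σ * (‖Y₁‖ + ‖Y₂‖ + ‖Y₃‖ + ‖Y₄‖) =
      (2 * σ * ‖Y₁‖ + σ * ‖Y₁‖) + (2 * σ * ‖Y₂‖ + σ * ‖Y₂‖) + (2 * σ * ‖Y₃‖ + σ * ‖Y₃‖) +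
        (2 * σ * ‖Y₄‖ + σ * ‖Y₄‖) := by ring
  rw [e]
  exact add_le_add (add_le_add (add_le_add (add_le_add a1 b1) (add_le_add a2 b2)) (add_le_add a3 b3))
    (add_le_add a4 b4)

end Summit.QuantumFields.YangMills.Theorems.FemtoCurvatureTwoPointC.Doubling.ConeAlgebra

end
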